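import Mathlib.Analysis.Convex.Integral
import Summits.QuantumFields.GaugeBoot.BootstrapReflectionCutConsistency
import HarnessLib

/-!
# Gauge-averaged density: GAUGE-INVARIANT polynomial observables are `L²`-dense among the
# gauge-invariant observables, and reflection positivity on gauge-invariant data is decided by them
# (gauge-boot, L3 ↔ L1)

HONEST FRAMING (cell `pub-gaugeboot`, page 1 of every file): the venture produces certified bounds
on lattice expectations at stated coupling, gauge group, dimension and torus size; NOT a mass gap,
NOT a continuum limit, NOT a string tension; NOT Yang–Mills-summit-bearing (barriers
`FixedCouplingUltralocality`, `PerturbativeInvisibility`). Structural measure theory; it certifies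
no number.

## Content

A Kazakov–Zheng bootstrap sees only GAUGE-INVARIANT data (Wilson loops), so its reflection cuts are
`0 ≤ φ ((p ∘ Θ) · p)` for gauge-invariant `S`-supported polynomial observables `p`
(`diagRpLevelValuesSuN` of `BootstrapDiagonalReflectionPositivity`). `BootstrapRPCutDensity` proved
that PLAIN `S`-supported polynomials decide reflection positivity; this module adds the
gauge-invariant version, by GAUGE AVERAGING the polynomial approximant (`gaugeAvgL`):

* ★★ `integral_sq_sub_gaugeAvgL_le` — for a gauge-invariant probability measure `μ` on the torus
  configurations, a gauge-invariant bounded measurable real `F` and any continuous `q`: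
  `∫ (F - A q)² dμ ≤ ∫ (F - q)² dμ` (Jensen on the gauge group + Fubini + invariance of `μ`);
  `eLpNorm_sub_gaugeAvgL_le` — the same in `L²(μ)` norm;
* `dependsOn_gaugeAvgL` — `A q` depends only on the links `q` depends on;
* ★★ `exists_giPoly_dependsOn_eLpNorm_sub_le` — DENSITY: a gauge-invariant bounded measurable real
  observable supported in `S` is `L²(μ)`-close to a GAUGE-INVARIANT `S`-supported POLYNOMIAL
  observable (`μ` any gauge-invariant probability measure, e.g. `wilsonMeasure`);
  `exists_giPoly_pair_approx_complex` — complex form;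
* ★★★ `giRp_of_giPoly_rp` — `μ` gauge invariant, preserved by the involution `Θ`: if
  `0 ≤ ∫ p(ΘU) p(U) dμ` for every gauge-invariant `S`-supported polynomial `p`, then
  `0 ≤ ∫ (F∘Θ)‾ F dμ` for every gauge-invariant `S`-supported bounded measurable complex `F`.

References: K. Osterwalder, E. Seiler, Ann. Phys. 110 (1978) 440 §2; V. Kazakov, Z. Zheng,
arXiv:2203.11360 §3.1; J. Glimm, A. Jaffe, Quantum Physics (1987) §6.1. Standard; folklore.
-/

noncomputable section

open MeasureTheory Filter Topology NormedSpace
open scoped ENNReal ComplexConjugate ComplexOrder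
open Literature.MathematicalPhysics.QuantumFieldTheory (LatticeRep Site Edge GaugeConfig gaugeTransform
  IsGaugeInvariant haarProbability)

namespace Summit.QuantumFields.GaugeBoot

section GaugeAverage

variable {d L : ℕ} [NeZero L] {G : Type*} [Group G] [TopologicalSpace G] [IsTopologicalGroup G]
  [CompactSpace G] [T2Space G] [SecondCountableTopology G] [MeasurableSpace G] [BorelSpace G]

/-! ## The gauge average is an `L²`-contraction towards gauge-invariant targets -/

omit [T2Space G] in
/-- ★★ **Jensen + Fubini + invariance**: for a gauge-invariant probability measure `μ` on the torus
configurations, a GAUGE-INVARIANT bounded measurable real observable `F` and any continuous `q`,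
`∫ (F - A q)² dμ ≤ ∫ (F - q)² dμ`, `A = gaugeAvgL` the average over the gauge group. [folklore] -/
theorem integral_sq_sub_gaugeAvgL_le (μ : Measure (GaugeConfig d L G)) [IsProbabilityMeasure μ]
    (hμ : ∀ g : Site d L → G, μ.map (gaugeTransform g) = μ)
    {F : GaugeConfig d L G → ℝ} (hF : Measurable F) {C : ℝ} (hC : ∀ U, |F U| ≤ C)
    (hFG : IsGaugeInvariant F) (q : C(GaugeConfig d L G, ℝ)) :
    ∫ U, (F U - gaugeAvgL d L G q U) ^ 2 ∂μ ≤ ∫ U, (F U - q U) ^ 2 ∂μ := by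
  set ν : Measure (Site d L → G) := haarProbability (Site d L → G) with hν
  have hcont : Continuous fun p : (Site d L → G) × GaugeConfig d L G => gaugeTransform p.1 p.2 :=
    gaugeTransform_action.2
  -- the integrand `h U g = F U - q (U^g)`, continuous in `g`, jointly measurable, bounded
  have hhc : ∀ U, Continuous fun g : Site d L → G => F U - q (gaugeTransform g U) := fun U =>
    continuous_const.sub (q.continuous.comp (hcont.comp (continuous_id.prodMk continuous_const)))
  have hbound : ∀ U g, |F U - q (gaugeTransform g U)| ≤ C + ‖q‖ := fun U g =>
    (abs_sub _ _).trans (add_le_add (hC U) (by simpa using q.norm_coe_le_norm (gaugeTransform g U)))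
  have hint : ∀ U, Integrable (fun g => F U - q (gaugeTransform g U)) ν := fun U =>
    Integrable.of_bound (hhc U).measurable.aestronglyMeasurable (C + ‖q‖)
      (ae_of_all _ fun g => by rw [Real.norm_eq_abs]; exact hbound U g)
  have hint2 : ∀ U, Integrable (fun g => (F U - q (gaugeTransform g U)) ^ 2) ν := fun U =>
    Integrable.of_bound ((hhc U).pow 2).measurable.aestronglyMeasurable ((C + ‖q‖) ^ 2)
      (ae_of_all _ fun g => by
        rw [Real.norm_eq_abs, abs_pow]
        exact pow_le_pow_left₀ (abs_nonneg _) (hbound U g) 2)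
  have hintq : ∀ U, Integrable (fun g => q (gaugeTransform g U)) ν := fun U =>
    Integrable.of_bound (q.continuous.comp (hcont.comp (continuous_id.prodMk continuous_const))).measurable.aestronglyMeasurable
      ‖q‖ (ae_of_all _ fun g => q.norm_coe_le_norm _)
  -- pointwise: `F U - A q U = ∫ (F U - q (U^g)) dν(g)`
  have hpt : ∀ U, F U - gaugeAvgL d L G q U = ∫ g, (F U - q (gaugeTransform g U)) ∂ν := by
    intro U
    have hsub := integral_sub (integrable_const (F U)) (hintq U)
    rw [integral_const, probReal_univ, one_smul] at hsub
    rw [hsub, gaugeAvgL_apply]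
  -- Jensen pointwise: `(∫ h)² ≤ ∫ h²`
  have hjensen : ∀ U, (F U - gaugeAvgL d L G q U) ^ 2 ≤ ∫ g, (F U - q (gaugeTransform g U)) ^ 2 ∂ν := by
    intro U
    rw [hpt U]
    exact (Even.convexOn_pow even_two).map_integral_le (continuousOn_pow 2) isClosed_univ
      (ae_of_all _ fun _ => Set.mem_univ _) (hint U) (hint2 U)
  -- joint integrability on `μ.prod ν`
  have hmeas2 : Measurable (Function.uncurry fun (U : GaugeConfig d L G) (g : Site d L → G) =>
      (F U - q (gaugeTransform g U)) ^ 2) := by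
    have h1 : Measurable fun p : GaugeConfig d L G × (Site d L → G) => F p.1 := hF.comp measurable_fst
    have h2 : Measurable fun p : GaugeConfig d L G × (Site d L → G) => q (gaugeTransform p.2 p.1) :=
      (q.continuous.comp (hcont.comp continuous_swap)).measurable
    exact (h1.sub h2).pow_const 2
  have hprod : Integrable (Function.uncurry fun (U : GaugeConfig d L G) (g : Site d L → G) =>
      (F U - q (gaugeTransform g U)) ^ 2) (μ.prod ν) :=
    Integrable.of_bound hmeas2.aestronglyMeasurable ((C + ‖q‖) ^ 2)
      (ae_of_all _ fun p => by
        rw [Function.uncurry_apply_pair, Real.norm_eq_abs, abs_pow]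
        exact pow_le_pow_left₀ (abs_nonneg _) (hbound p.1 p.2) 2)
  -- invariance: for each `g`, `∫ (F U - q(U^g))² dμ = ∫ (F - q)² dμ`
  have hinv : ∀ g : Site d L → G, ∫ U, (F U - q (gaugeTransform g U)) ^ 2 ∂μ = ∫ U, (F U - q U) ^ 2 ∂μ := by
    intro g
    have hgm : Measurable (gaugeTransform (d := d) (L := L) (G := G) g) :=
      (hcont.comp (continuous_const.prodMk continuous_id)).measurable
    have hφ : AEStronglyMeasurable (fun V : GaugeConfig d L G => (F V - q V) ^ 2) (μ.map (gaugeTransform g)) :=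
      ((hF.sub q.continuous.measurable).pow_const 2).aestronglyMeasurable
    calc ∫ U, (F U - q (gaugeTransform g U)) ^ 2 ∂μ
        = ∫ U, (fun V => (F V - q V) ^ 2) (gaugeTransform g U) ∂μ :=
          integral_congr_ae (ae_of_all _ fun U => by simp only [hFG g U])
      _ = ∫ V, (F V - q V) ^ 2 ∂(μ.map (gaugeTransform g)) := (integral_map hgm.aemeasurable hφ).symm
      _ = ∫ U, (F U - q U) ^ 2 ∂μ := by rw [hμ g]
  -- assemble
  have hLint : Integrable (fun U => (F U - gaugeAvgL d L G q U) ^ 2) μ :=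
    Integrable.of_bound (((hF.sub (gaugeAvgL d L G q).continuous.measurable).pow_const 2).aestronglyMeasurable)
      ((C + ‖gaugeAvgL d L G q‖) ^ 2) (ae_of_all _ fun U => by
        rw [Real.norm_eq_abs, abs_pow]
        refine pow_le_pow_left₀ (abs_nonneg _) ((abs_sub _ _).trans (add_le_add (hC U) ?_)) 2
        simpa using (gaugeAvgL d L G q).norm_coe_le_norm U)
  calc ∫ U, (F U - gaugeAvgL d L G q U) ^ 2 ∂μ
      ≤ ∫ U, ∫ g, (F U - q (gaugeTransform g U)) ^ 2 ∂ν ∂μ :=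
        integral_mono hLint hprod.integral_prod_left hjensen
    _ = ∫ g, ∫ U, (F U - q (gaugeTransform g U)) ^ 2 ∂μ ∂ν := integral_integral_swap hprod
    _ = ∫ g, ∫ U, (F U - q U) ^ 2 ∂μ ∂ν := integral_congr_ae (ae_of_all _ fun g => hinv g)
    _ = ∫ U, (F U - q U) ^ 2 ∂μ := by rw [integral_const, probReal_univ, one_smul]

omit [T2Space G] in
/-- **The gauge average is an `L²(μ)`-contraction towards gauge-invariant targets**:
`‖F - A q‖_{L²(μ)} ≤ ‖F - q‖_{L²(μ)}` (`μ` gauge invariant, `F` gauge invariant bounded measurable,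
`q` continuous). [folklore] -/
theorem eLpNorm_sub_gaugeAvgL_le (μ : Measure (GaugeConfig d L G)) [IsProbabilityMeasure μ]
    (hμ : ∀ g : Site d L → G, μ.map (gaugeTransform g) = μ)
    {F : GaugeConfig d L G → ℝ} (hF : Measurable F) {C : ℝ} (hC : ∀ U, |F U| ≤ C)
    (hFG : IsGaugeInvariant F) (q : C(GaugeConfig d L G, ℝ)) :
    eLpNorm (F - ⇑(gaugeAvgL d L G q)) 2 μ ≤ eLpNorm (F - ⇑q) 2 μ := by
  -- `‖f‖₂ = ofReal (sqrt ∫ f²)` for bounded measurable `f`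
  have key : ∀ f : GaugeConfig d L G → ℝ, Measurable f → (∃ B, ∀ U, |f U| ≤ B) →
      eLpNorm f 2 μ = ENNReal.ofReal (Real.sqrt (∫ U, f U ^ 2 ∂μ)) := by
    intro f hf ⟨B, hB⟩
    have hmem : MemLp f 2 μ :=
      MemLp.of_bound hf.aestronglyMeasurable B (ae_of_all _ fun U => by rw [Real.norm_eq_abs]; exact hB U)
    rw [hmem.eLpNorm_eq_integral_rpow_norm two_ne_zero ENNReal.ofNat_ne_top]
    simp only [ENNReal.toReal_ofNat, Real.rpow_two, sq_abs, Real.norm_eq_abs]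
    rw [Real.sqrt_eq_rpow, show ((2 : ℝ))⁻¹ = 1 / 2 by norm_num]
  have hb1 : ∃ B, ∀ U, |(F - ⇑(gaugeAvgL d L G q)) U| ≤ B :=
    ⟨C + ‖gaugeAvgL d L G q‖, fun U => (abs_sub _ _).trans
      (add_le_add (hC U) (by simpa using (gaugeAvgL d L G q).norm_coe_le_norm U))⟩
  have hb2 : ∃ B, ∀ U, |(F - ⇑q) U| ≤ B :=
    ⟨C + ‖q‖, fun U => (abs_sub _ _).trans (add_le_add (hC U) (by simpa using q.norm_coe_le_norm U))⟩
  rw [key _ (hF.sub (gaugeAvgL d L G q).continuous.measurable) hb1,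
    key _ (hF.sub q.continuous.measurable) hb2]
  exact ENNReal.ofReal_le_ofReal (Real.sqrt_le_sqrt (integral_sq_sub_gaugeAvgL_le μ hμ hF hC hFG q))

omit [NeZero L] [TopologicalSpace G] [IsTopologicalGroup G] [CompactSpace G] [T2Space G] [SecondCountableTopology G]
  [MeasurableSpace G] [BorelSpace G] in
/-- Gauge transformations act linkwise: configurations agreeing on `S` have gauge transforms
agreeing on `S`. -/
theorem gaugeTransform_congr_on {S : Set (Edge d L)} {U V : GaugeConfig d L G}
    (hUV : ∀ e ∈ S, U e = V e) (g : Site d L → G) :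
    ∀ e ∈ S, gaugeTransform g U e = gaugeTransform g V e := fun e he => by
  simp only [gaugeTransform, hUV e he]

omit [T2Space G] in
/-- **The gauge average of an `S`-supported observable is `S`-supported.** -/
theorem dependsOn_gaugeAvgL {S : Set (Edge d L)} {q : C(GaugeConfig d L G, ℝ)} (hq : DependsOn (⇑q) S) :
    DependsOn (⇑(gaugeAvgL d L G q)) S := by
  intro U V hUV
  rw [gaugeAvgL_apply, gaugeAvgL_apply]
  exact integral_congr_ae (ae_of_all _ fun g => hq (gaugeTransform_congr_on hUV g))

variable (r : LatticeRep G)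

/-- ★★ **Density of GAUGE-INVARIANT polynomials**: `μ` a gauge-invariant probability measure on the
torus configurations, `S` any link set, `F` a bounded measurable real observable which is gauge
invariant and depends only on the links of `S`, `ε ≠ 0`: there is a gauge-invariant polynomial
observable `q ∈ polyAlgebra r` with `DependsOn q S` and `‖F - q‖_{L²(μ)} ≤ ε`
(`exists_poly_dependsOn_eLpNorm_sub_le` + gauge averaging). [folklore] -/
theorem exists_giPoly_dependsOn_eLpNorm_sub_le (μ : Measure (GaugeConfig d L G)) [IsProbabilityMeasure μ]
    (hμ : ∀ g : Site d L → G, μ.map (gaugeTransform g) = μ)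
    (S : Set (Edge d L)) {F : GaugeConfig d L G → ℝ} (hF : Measurable F) {C : ℝ} (hC : ∀ U, |F U| ≤ C)
    (hFG : IsGaugeInvariant F) (hFS : DependsOn F S) {ε : ℝ≥0∞} (hε : ε ≠ 0) :
    ∃ q ∈ polyAlgebra (ι := Edge d L) r, IsGaugeInvariant (⇑q) ∧ DependsOn (⇑q) S ∧ eLpNorm (F - ⇑q) 2 μ ≤ ε := by
  obtain ⟨q₀, hq₀, hq₀S, hq₀ε⟩ := exists_poly_dependsOn_eLpNorm_sub_le r μ S hF hC hFS hε
  exact ⟨gaugeAvgL d L G q₀, gaugeAvgL_mem_polyAlgebra r hq₀, isGaugeInvariant_gaugeAvgL q₀,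
    dependsOn_gaugeAvgL hq₀S, (eLpNorm_sub_gaugeAvgL_le μ hμ hF hC hFG q₀).trans hq₀ε⟩

/-- **Complex form**: a gauge-invariant bounded measurable complex `S`-supported observable is within
`ε` in `L²(μ)` of `q₁ + i q₂` with `q₁, q₂` GAUGE-INVARIANT polynomial `S`-supported observables. -/
theorem exists_giPoly_pair_approx_complex (μ : Measure (GaugeConfig d L G)) [IsProbabilityMeasure μ]
    (hμ : ∀ g : Site d L → G, μ.map (gaugeTransform g) = μ)
    (S : Set (Edge d L)) {F : GaugeConfig d L G → ℂ} (hF : Measurable F) {C : ℝ} (hC : ∀ U, ‖F U‖ ≤ C)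
    (hFG : IsGaugeInvariant F) (hFS : DependsOn F S) {ε : ℝ} (hε : 0 < ε) :
    ∃ q₁ ∈ polyAlgebra (ι := Edge d L) r, ∃ q₂ ∈ polyAlgebra (ι := Edge d L) r,
      IsGaugeInvariant (⇑q₁) ∧ IsGaugeInvariant (⇑q₂) ∧ DependsOn (⇑q₁) S ∧ DependsOn (⇑q₂) S ∧
        (eLpNorm (F - fun U => ((q₁ U : ℂ) + (q₂ U : ℂ) * Complex.I)) 2 μ).toReal ≤ ε := by
  classical
  have hε2 : ENNReal.ofReal (ε / 2) ≠ 0 := by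
    simpa [ENNReal.ofReal_eq_zero, not_le] using half_pos hε
  have hre : ∀ U, |(F U).re| ≤ C := fun U => (Complex.abs_re_le_norm _).trans (hC U)
  have him : ∀ U, |(F U).im| ≤ C := fun U => (Complex.abs_im_le_norm _).trans (hC U)
  obtain ⟨q₁, hq₁, hG₁, hS₁, hε₁⟩ := exists_giPoly_dependsOn_eLpNorm_sub_le r μ hμ S
    (Complex.measurable_re.comp hF) hre (fun g U => by simp only [Function.comp_apply, hFG g U])
    (fun U V h => by simp only [Function.comp_apply, hFS h]) hε2
  obtain ⟨q₂, hq₂, hG₂, hS₂, hε₂⟩ := exists_giPoly_dependsOn_eLpNorm_sub_le r μ hμ S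
    (Complex.measurable_im.comp hF) him (fun g U => by simp only [Function.comp_apply, hFG g U])
    (fun U V h => by simp only [Function.comp_apply, hFS h]) hε2
  refine ⟨q₁, hq₁, q₂, hq₂, hG₁, hG₂, hS₁, hS₂, ?_⟩
  set K : GaugeConfig d L G → ℂ := fun U => (q₁ U : ℂ) + (q₂ U : ℂ) * Complex.I with hK
  have hdecomp : F - K = (fun U => (((fun U => (F U).re) - ⇑q₁) U : ℂ)) +
      fun U => (((fun U => (F U).im) - ⇑q₂) U : ℂ) * Complex.I := by
    funext U
    simp only [hK, Pi.sub_apply, Pi.add_apply, Complex.ofReal_sub]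
    rw [← Complex.re_add_im (F U)]
    simp only [Complex.add_re, Complex.ofReal_re, Complex.mul_re, Complex.I_re, mul_zero,
      Complex.ofReal_im, Complex.I_im, mul_one, sub_self, add_zero, Complex.add_im,
      Complex.mul_im, zero_add]
    ring
  have hm1 : AEStronglyMeasurable (fun U => (((fun U => (F U).re) - ⇑q₁) U : ℂ)) μ :=
    (Complex.measurable_ofReal.comp ((Complex.measurable_re.comp hF).sub
      q₁.continuous.measurable)).aestronglyMeasurable
  have hm2 : AEStronglyMeasurable (fun U => (((fun U => (F U).im) - ⇑q₂) U : ℂ) * Complex.I) μ :=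
    ((Complex.measurable_ofReal.comp ((Complex.measurable_im.comp hF).sub
      q₂.continuous.measurable)).mul_const _).aestronglyMeasurable
  have h1 : eLpNorm (fun U => (((fun U => (F U).re) - ⇑q₁) U : ℂ)) 2 μ =
      eLpNorm ((fun U => (F U).re) - ⇑q₁) 2 μ :=
    eLpNorm_congr_norm_ae (ae_of_all _ fun U => by rw [Complex.norm_real])
  have h2 : eLpNorm (fun U => (((fun U => (F U).im) - ⇑q₂) U : ℂ) * Complex.I) 2 μ =
      eLpNorm ((fun U => (F U).im) - ⇑q₂) 2 μ :=
    eLpNorm_congr_norm_ae (ae_of_all _ fun U => by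
      rw [norm_mul, Complex.norm_I, mul_one, Complex.norm_real])
  have hsum : eLpNorm (F - K) 2 μ ≤ ENNReal.ofReal (ε / 2) + ENNReal.ofReal (ε / 2) := by
    rw [hdecomp]
    refine (eLpNorm_add_le hm1 hm2 one_le_two).trans ?_
    rw [h1, h2]
    exact add_le_add hε₁ hε₂
  have hfin : ENNReal.ofReal (ε / 2) + ENNReal.ofReal (ε / 2) ≠ ∞ := by simp
  calc (eLpNorm (F - K) 2 μ).toReal ≤ (ENNReal.ofReal (ε / 2) + ENNReal.ofReal (ε / 2)).toReal :=
        ENNReal.toReal_mono hfin hsum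
    _ = ε := by
        rw [ENNReal.toReal_add ENNReal.ofReal_ne_top ENNReal.ofReal_ne_top,
          ENNReal.toReal_ofReal (by linarith)]
        ring

/-! ## Reflection positivity on gauge-invariant data is decided by gauge-invariant polynomials -/

omit [IsTopologicalGroup G] [T2Space G] in
/-- **Real gauge-invariant polynomial RP gives complex RP on `q₁ + i q₂`** (`q₁, q₂` gauge-invariant
`S`-supported polynomials; `Θ` a `μ`-preserving involution; `RPDensity.integral_comp_mul_comm`). -/
theorem rpForm_giPoly_pair_nonneg (μ : Measure (GaugeConfig d L G)) [IsProbabilityMeasure μ]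
    {Θ : GaugeConfig d L G → GaugeConfig d L G} (hΘ : MeasurePreserving Θ μ μ)
    (hΘΘ : ∀ U, Θ (Θ U) = U) (S : Set (Edge d L))
    (hpoly : ∀ p ∈ polyAlgebra (ι := Edge d L) r, IsGaugeInvariant (⇑p) → DependsOn (⇑p) S →
      0 ≤ ∫ U, p (Θ U) * p U ∂μ)
    {q₁ q₂ : C(GaugeConfig d L G, ℝ)} (hq₁ : q₁ ∈ polyAlgebra (ι := Edge d L) r)
    (hq₂ : q₂ ∈ polyAlgebra (ι := Edge d L) r) (hG₁ : IsGaugeInvariant (⇑q₁)) (hG₂ : IsGaugeInvariant (⇑q₂))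
    (hS₁ : DependsOn (⇑q₁) S) (hS₂ : DependsOn (⇑q₂) S) :
    0 ≤ ∫ U, conj ((q₁ (Θ U) : ℂ) + (q₂ (Θ U) : ℂ) * Complex.I) *
      ((q₁ U : ℂ) + (q₂ U : ℂ) * Complex.I) ∂μ := by
  have hΘm : Measurable Θ := hΘ.measurable
  have hint : ∀ f g : C(GaugeConfig d L G, ℝ), Integrable (fun U => f (Θ U) * g U) μ := fun f g =>
    Integrable.of_bound ((f.continuous.measurable.comp hΘm).mul g.continuous.measurable).aestronglyMeasurable
      (‖f‖ * ‖g‖) (ae_of_all _ fun U => by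
        rw [norm_mul]
        exact mul_le_mul (f.norm_coe_le_norm _) (g.norm_coe_le_norm _) (norm_nonneg _) (norm_nonneg _))
  have hpt : ∀ U, conj ((q₁ (Θ U) : ℂ) + (q₂ (Θ U) : ℂ) * Complex.I) * ((q₁ U : ℂ) + (q₂ U : ℂ) * Complex.I) =
      ((q₁ (Θ U) * q₁ U + q₂ (Θ U) * q₂ U : ℝ) : ℂ) +
        ((q₁ (Θ U) * q₂ U - q₂ (Θ U) * q₁ U : ℝ) : ℂ) * Complex.I := fun U => by
    simp only [map_add, map_mul, Complex.conj_ofReal, Complex.conj_I]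
    push_cast
    linear_combination (-((q₂ (Θ U) : ℂ) * (q₂ U : ℂ))) * Complex.I_mul_I
  simp_rw [hpt]
  have hAi : Integrable (fun U => ((q₁ (Θ U) * q₁ U + q₂ (Θ U) * q₂ U : ℝ) : ℂ)) μ :=
    ((hint q₁ q₁).add (hint q₂ q₂)).ofReal
  have hBi : Integrable (fun U => ((q₁ (Θ U) * q₂ U - q₂ (Θ U) * q₁ U : ℝ) : ℂ) * Complex.I) μ :=
    ((hint q₁ q₂).sub (hint q₂ q₁)).ofReal.mul_const _
  rw [integral_add hAi hBi, integral_mul_const, integral_complex_ofReal, integral_complex_ofReal,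
    integral_sub (hint q₁ q₂) (hint q₂ q₁), integral_add (hint q₁ q₁) (hint q₂ q₂),
    RPDensity.integral_comp_mul_comm hΘ hΘΘ q₁.continuous.measurable q₂.continuous.measurable, sub_self,
    Complex.ofReal_zero, zero_mul, add_zero, Complex.zero_le_real]
  exact add_nonneg (hpoly q₁ hq₁ hG₁ hS₁) (hpoly q₂ hq₂ hG₂ hS₂)

/-- ★★★ **Reflection positivity on GAUGE-INVARIANT data is decided by gauge-invariant polynomial
observables.** `μ` a gauge-invariant probability measure on the torus configurations preserved by
the involution `Θ`, `S` a link set. If `0 ≤ ∫ p(ΘU) p(U) dμ` for every gauge-invariant polynomial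
observable `p` with `DependsOn p S` (the cut family of a bootstrap on Wilson-loop data), then
`0 ≤ ∫ (F∘Θ)‾ F dμ` for every gauge-invariant bounded measurable complex `F` with `DependsOn F S`.
[folklore] -/
theorem giRp_of_giPoly_rp (μ : Measure (GaugeConfig d L G)) [IsProbabilityMeasure μ]
    (hμ : ∀ g : Site d L → G, μ.map (gaugeTransform g) = μ)
    {Θ : GaugeConfig d L G → GaugeConfig d L G} (hΘ : MeasurePreserving Θ μ μ)
    (hΘΘ : ∀ U, Θ (Θ U) = U) (S : Set (Edge d L))
    (hpoly : ∀ p ∈ polyAlgebra (ι := Edge d L) r, IsGaugeInvariant (⇑p) → DependsOn (⇑p) S →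
      0 ≤ ∫ U, p (Θ U) * p U ∂μ)
    {F : GaugeConfig d L G → ℂ} (hF : Measurable F) (hFb : ∃ C : ℝ, ∀ U, ‖F U‖ ≤ C)
    (hFG : IsGaugeInvariant F) (hFS : DependsOn F S) :
    0 ≤ ∫ U, conj (F (Θ U)) * F U ∂μ := by
  obtain ⟨CF, hCF⟩ := hFb
  set B : ℂ := ∫ U, conj (F (Θ U)) * F U ∂μ with hB
  set M : ℝ := (eLpNorm F 2 μ).toReal with hM
  have hM0 : 0 ≤ M := ENNReal.toReal_nonneg
  have key : ∀ η : ℝ, 0 < η → -η ≤ B.re ∧ |B.im| ≤ η := by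
    intro η hη
    set ε : ℝ := min 1 (η / (2 * M + 1)) with hεdef
    have hε : 0 < ε := lt_min one_pos (div_pos hη (by linarith))
    have hε1 : ε ≤ 1 := min_le_left _ _
    have hεη : ε * (2 * M + 1) ≤ η := by
      have : ε ≤ η / (2 * M + 1) := min_le_right _ _
      rwa [le_div_iff₀ (by linarith)] at this
    obtain ⟨q₁, hq₁, q₂, hq₂, hG₁, hG₂, hS₁, hS₂, hFK⟩ :=
      exists_giPoly_pair_approx_complex r μ hμ S hF hCF hFG hFS hε
    have hpos := rpForm_giPoly_pair_nonneg r μ hΘ hΘΘ S hpoly hq₁ hq₂ hG₁ hG₂ hS₁ hS₂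
    set K : GaugeConfig d L G → ℂ := fun U => (q₁ U : ℂ) + (q₂ U : ℂ) * Complex.I with hK
    have hposK : 0 ≤ ∫ U, conj (K (Θ U)) * K U ∂μ := by simpa only [hK] using hpos
    have hKm : Measurable K :=
      (Complex.measurable_ofReal.comp q₁.continuous.measurable).add
        ((Complex.measurable_ofReal.comp q₂.continuous.measurable).mul_const _)
    have hCK : ∀ U, ‖K U‖ ≤ ‖q₁‖ + ‖q₂‖ := fun U => by
      refine (norm_add_le _ _).trans (add_le_add ?_ ?_)
      · rw [Complex.norm_real]; exact q₁.norm_coe_le_norm U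
      · rw [norm_mul, Complex.norm_I, mul_one, Complex.norm_real]; exact q₂.norm_coe_le_norm U
    have hdiff := RPDensity.rpForm_sub_le hΘ hF hCF hKm hCK
    have hFm : MemLp F 2 μ := RPDensity.memLp_two_of_bound hF hCF
    have hKmm : MemLp K 2 μ := RPDensity.memLp_two_of_bound hKm hCK
    have hKnorm : (eLpNorm K 2 μ).toReal ≤ M + ε := by
      have htri : eLpNorm K 2 μ ≤ eLpNorm F 2 μ + eLpNorm (F - K) 2 μ := by
        have : K = F - (F - K) := by simp
        rw [this]
        exact (eLpNorm_sub_le hFm.aestronglyMeasurable (hFm.sub hKmm).aestronglyMeasurable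
          one_le_two).trans (by rw [← this])
      calc (eLpNorm K 2 μ).toReal ≤ (eLpNorm F 2 μ + eLpNorm (F - K) 2 μ).toReal :=
            ENNReal.toReal_mono (ENNReal.add_ne_top.2 ⟨hFm.eLpNorm_ne_top, (hFm.sub hKmm).eLpNorm_ne_top⟩)
              htri
        _ = M + (eLpNorm (F - K) 2 μ).toReal :=
            ENNReal.toReal_add hFm.eLpNorm_ne_top (hFm.sub hKmm).eLpNorm_ne_top
        _ ≤ M + ε := by linarith
    have hbound : ‖B - ∫ U, conj (K (Θ U)) * K U ∂μ‖ ≤ η := by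
      refine hdiff.trans ?_
      calc (eLpNorm (F - K) 2 μ).toReal * ((eLpNorm F 2 μ).toReal + (eLpNorm K 2 μ).toReal)
          ≤ ε * (M + (M + ε)) := mul_le_mul hFK (by linarith) (by positivity) hε.le
        _ ≤ ε * (2 * M + 1) := by nlinarith
        _ ≤ η := hεη
    obtain ⟨hKre, hKim⟩ := Complex.nonneg_iff.1 hposK
    have hre := (Complex.abs_re_le_norm _).trans hbound
    have him := (Complex.abs_im_le_norm _).trans hbound
    rw [Complex.sub_re] at hre
    rw [Complex.sub_im, ← hKim, sub_zero] at him
    constructor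
    · have := neg_abs_le (B.re - (∫ U, conj (K (Θ U)) * K U ∂μ).re)
      linarith
    · exact him
  have hre : 0 ≤ B.re := by
    by_contra hlt
    have hlt' : B.re < 0 := not_le.1 hlt
    have := (key (-B.re / 2) (by linarith)).1
    linarith
  have him : B.im = 0 := by
    by_contra hne
    have hpos : 0 < |B.im| := abs_pos.2 hne
    have := (key (|B.im| / 2) (by linarith)).2
    linarith
  exact Complex.nonneg_iff.2 ⟨hre, him.symm⟩

end GaugeAverage

end Summit.QuantumFields.GaugeBoot

end
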